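import Literature.NumberTheory.GaloisCohomology.Howard2004.TransverseConditionRingClassKernelProofs
import Literature.NumberTheory.GaloisCohomology.Howard2004.TransportUnramified
import Literature.NumberTheory.GaloisRepresentations.ContinuousCupProductCompat
import Literature.NumberTheory.GaloisRepresentations.ContinuousH1TrivialAction
import HarnessLib

/-!
# Howard 2004, H.4 at a prime `λ ∣ n`: the transverse condition is ISOTROPIC under the induced local
# pairing — cup products of classes inflated from a cyclic quotient vanish for odd coefficients (proofs)

Topic `NumberTheory/GaloisCohomology/Howard2004`. THEOREMS ONLY: no definition, no named fact, no instance, no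
notation, no `sorry`. Cell `pub/bsd-print-x9`, print leaf G87
`Literature.NumberTheory.GaloisCohomology.Howard2004.thm161_dvrKolyvaginBound` (Howard Thm. 1.6.1); seat
`bsd-line-x9-p1-w4` g16, brick (TR-ISO); sequel to x9-p1-w3's `TransverseConditionRingClassKernelProofs`
(`H¹_tr(K_λ, T) = ker(H¹(K_λ, T) → H¹(Γ_{K_λ} ∩ Γ_{K[ℓ]}, T))`).

SOURCE / WHY. B. Howard, *The Heegner point Kolyvagin system*, Compositio Math. **140** (2004) = arXiv:1202.6340.
Lemma 1.5.6 (p. 10 L86–88): «The local condition `𝓕^m(n)` is maximal isotropic away from `m` under the local Tate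
pairing» — at the primes `λ ∣ n` the condition is the TRANSVERSE one `H¹_tr(K_λ, T)` (§1.2, Def. 1.2.2), and its
isotropy under Howard's induced pairing `⟨x, y⟩_λ = x ∪_e transport_λ(y)` (H.4, p. 7 L78–82) is the hypothesis `htr`
of the Lagrangian algebra (`LagrangianSubmodulesDeltaTransfer`, «isotropy of the finite and transverse submodules»,
Lemma 1.5.7 p. 10 L118–119) and one half of H.4 for `𝓕(n)` at `λ ∣ n` (`DualityDatum.IsSelfOrthogonalAt`).  At a
Kolyvagin prime the local actions on `T`, `Tw T` and `R(1)` are trivial (`ℓ ∈ 𝓛_k`: `Frob_λ ≡ 1`, `p^k ∣ ℓ + 1`), the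
transverse classes are the homomorphisms `Γ_{K_λ} → T` killing `Λ = Γ_{K_λ} ∩ Γ_{K[ℓ]}`, and `Γ_{K_λ}/Λ ↪ Gal(K[ℓ]_λ/K_λ)`
is cyclic; the cup product of two such classes is then `2`-torsion by graded commutativity, hence zero for `p` odd.

WHAT IS PROVED.
* §1 [folklore] **`ContPairing.cupProduct_eq_zero_of_factor_cyclic`**: for a continuous pairing `P : X × Y → Z` of
  topological `G`-modules with TRIVIAL actions on `X` and `Y`, a subgroup `Λ ≤ G` and `σ₀ ∈ G` with `G = ⋃_j σ₀^j Λ`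
  (`hcyc`), continuous crossed homomorphisms `f : G → X`, `g : G → Y` killing `Λ`, and `Z` killed by an ODD integer:
  `[f] ∪_P [g] = 0` in `H²_cont(G, Z)`.  Proof: `f(σ₀^a λ) = a • f(σ₀)` etc., so the `2`-cocycles `f ∪ g` and
  `g ∪' f` (flipped pairing) coincide: `(σ, τ) ↦ a_σ a_τ • P(f σ₀, g σ₀)`; graded commutativity
  (`ContPairing.cupProduct_comm`) gives `2 • ([f] ∪ [g]) = 0`, and `N • H² = 0` for `N` odd.
* §2 Howard: **`DualityDatum.localCup_eq_zero_of_mem_transverseCondition`** — at a finite place `v` of residue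
  characteristic `ℓ` with trivial local actions of `Γ_{K_v}` on `T` and on `Tw T`, `T` `p`-primary, the level ring `R`
  killed by an odd `N` (`p` odd, `p^k R = 0`), and `Γ_{K_v} = ⋃_j σ₀^j (Γ_{K_v} ∩ Γ_{K[ℓ]})`: `x ∪_e y = 0` for
  `x ∈ H¹_tr(K_v, T)`, `y ∈ H¹_tr(K_v, Tw T)`; **`ConjugationDatum.transportH1_mem_transverseCondition`** — the
  transport carries `H¹_tr(K_{σ v}, T)` into `H¹_tr(K_v, Tw T)` when `φ_v(Γ_{K_v} ∩ Γ_{K[ℓ]}) ⊆ Γ_{K_{σv}} ∩ Γ_{K[ℓ]}`;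
  hence **`DualityDatum.localCup_transportH1_eq_zero_of_mem_transverseCondition`**: `x ∪_e transport_v(y') = 0` for
  `x ∈ H¹_tr(K_v, T)`, `y' ∈ H¹_tr(K_{σ v}, T)` — the isotropy half of H.4 for the transverse structure at `v`
  (`htr` of the Lagrangian algebra at an inert Kolyvagin prime).

NOT HERE: the exactness half of H.4 for `H¹_tr` (isotropy + the count `#H¹_tr² = #H¹`, cf. `RelaxedSelmerLagrangianCountProofs`),
the cyclicity input `hcyc` and the trivial actions at `ℓ ∈ 𝓛_k` (x9-p1-w3's Prop 1.1.9 files), `φ_v` preserving the ring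
class subgroup; `thm161_dvrKolyvaginBound` is NOT proved; no summit statement is proved; the Birch–Swinnerton-Dyer
conjecture is not proved by any of this.
References: [Howard2004HeegnerKolyvagin] §1.2, Def. 1.2.2, §1.3 H.4, Lemma 1.5.6–1.5.7; [NeukirchSchmidtWingberg2008] I §4
(1.4.4) (graded commutativity); [SerreGaloisCohomology1997] I §2.3 (H¹ of a trivial module).
-/

set_option autoImplicit false

noncomputable section

open CategoryTheory Function NumberField IsDedekindDomain Field
open scoped NumberField

/-! ## §1 Cup products of classes inflated from a cyclic quotient vanish for odd coefficients -/

namespace Literature.NumberTheory.GaloisRepresentations.ContPairing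

universe u v

variable {R : Type u} [CommRing R] [TopologicalSpace R]
  {G : Type v} [Group G] [TopologicalSpace G] [IsTopologicalGroup G] [LocallyCompactSpace G]
  {X Y Z : TopRep.{v} R G} (P : ContPairing X Y Z)

omit [IsTopologicalGroup G] [LocallyCompactSpace G] in
/-- A continuous crossed homomorphism of a TRIVIAL module killing `Λ` is determined on `σ₀^j Λ` by its value at `σ₀`:
`f(σ) = j • f(σ₀)` whenever `(σ₀^j)⁻¹ σ ∈ Λ`. [cite: SerreGaloisCohomology1997, I §2.3 (H¹ of a trivial module = Hom)] -/
theorem apply_eq_nsmul_of_factor_cyclic (hX : ∀ (g : G) (x : X), X.ρ g x = x) (Λ : Subgroup G) (σ₀ : G)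
    (f : contOneCocycles X) (hf : ∀ l ∈ Λ, f.1 l = 0) {σ : G} {j : ℕ} (hj : (σ₀ ^ j)⁻¹ * σ ∈ Λ) :
    f.1 σ = j • f.1 σ₀ := by
  have hpow : ∀ i : ℕ, f.1 (σ₀ ^ i) = i • f.1 σ₀ := fun i => by
    induction i with
    | zero => rw [pow_zero, contOneCocycles.apply_one, zero_smul]
    | succ i ih => rw [pow_succ, contOneCocycles.apply_mul_of_trivial hX, ih, succ_nsmul]
  have hσ : σ = σ₀ ^ j * ((σ₀ ^ j)⁻¹ * σ) := by rw [mul_inv_cancel_left]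
  rw [hσ, contOneCocycles.apply_mul_of_trivial hX, hf _ hj, add_zero, hpow]

omit [LocallyCompactSpace G] in
/-- For trivial actions and crossed homomorphisms factoring through the cyclic quotient `G/Λ = ⟨σ₀⟩`, the cup-product
cocycle and the FLIPPED one coincide: `(f ∪ g)(σ, τ) = P(f σ, g τ) = a_σ a_τ • P(f σ₀, g σ₀) = (g ∪' f)(σ, τ)`.
[cite: NeukirchSchmidtWingberg2008, I §4 (1.4.4)] [cite: SerreGaloisCohomology1997, I §2.3] -/
theorem cupCocycle_eq_flip_of_factor_cyclic (hX : ∀ (g : G) (x : X), X.ρ g x = x) (hY : ∀ (g : G) (y : Y), Y.ρ g y = y)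
    (Λ : Subgroup G) (σ₀ : G) (hcyc : ∀ σ : G, ∃ j : ℕ, (σ₀ ^ j)⁻¹ * σ ∈ Λ)
    (f : contOneCocycles X) (g : contOneCocycles Y) (hf : ∀ l ∈ Λ, f.1 l = 0) (hg : ∀ l ∈ Λ, g.1 l = 0) :
    P.cupCocycle f g = P.flip.cupCocycle g f := by
  refine Subtype.ext (ContinuousMap.ext fun στ => ?_)
  obtain ⟨σ, τ⟩ := στ
  obtain ⟨a, ha⟩ := hcyc σ
  obtain ⟨b, hb⟩ := hcyc τ
  rw [cupCocycle_apply, cupCocycle_apply, flip_toLin_apply, contOneCocycles.apply_mul_of_trivial hY,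
    contOneCocycles.apply_mul_of_trivial hX, add_sub_cancel_left, add_sub_cancel_left,
    apply_eq_nsmul_of_factor_cyclic hX Λ σ₀ f hf ha, apply_eq_nsmul_of_factor_cyclic hX Λ σ₀ f hf hb,
    apply_eq_nsmul_of_factor_cyclic hY Λ σ₀ g hg ha, apply_eq_nsmul_of_factor_cyclic hY Λ σ₀ g hg hb]
  simp only [map_nsmul, LinearMap.smul_apply]
  rw [smul_smul, smul_smul, mul_comm]

/-- **Cup products of classes inflated from a cyclic quotient vanish for odd coefficients.**  Let `P : X × Y → Z` be a
continuous `G`-pairing with trivial actions on `X` and `Y`, `Λ ≤ G` and `σ₀` with `G = ⋃_j σ₀^j Λ`, `f`, `g` continuous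
crossed homomorphisms killing `Λ`, and `N • Z = 0` for an odd `N`.  Then `[f] ∪_P [g] = 0`: by graded commutativity
`[f] ∪ [g] = −[g] ∪' [f]`, the two cocycles coincide, so `2 • ([f] ∪ [g]) = 0 = N • ([f] ∪ [g])`.
[cite: NeukirchSchmidtWingberg2008, I §4 (1.4.4)] [cite: SerreGaloisCohomology1997, I §2.3] -/
theorem cupProduct_eq_zero_of_factor_cyclic (hX : ∀ (g : G) (x : X), X.ρ g x = x)
    (hY : ∀ (g : G) (y : Y), Y.ρ g y = y) (Λ : Subgroup G) (σ₀ : G) (hcyc : ∀ σ : G, ∃ j : ℕ, (σ₀ ^ j)⁻¹ * σ ∈ Λ)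
    (f : contOneCocycles X) (g : contOneCocycles Y) (hf : ∀ l ∈ Λ, f.1 l = 0) (hg : ∀ l ∈ Λ, g.1 l = 0)
    {N : ℕ} (hN : Odd N) (hZ : ∀ z : Z, N • z = 0) :
    P.cupProduct (oneCocycleClass X f) (oneCocycleClass Y g) = 0 := by
  have hcomm := P.cupProduct_comm (oneCocycleClass X f) (oneCocycleClass Y g)
  rw [cupProduct_oneCocycleClass_eq_twoCocycleClass, cupProduct_oneCocycleClass_eq_twoCocycleClass,
    ← P.cupCocycle_eq_flip_of_factor_cyclic hX hY Λ σ₀ hcyc f g hf hg] at hcomm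
  rw [cupProduct_oneCocycleClass_eq_twoCocycleClass]
  set c := twoCocycleClass Z (P.cupCocycle f g) with hc
  -- `N • c = 0`
  have hNc : N • c = 0 := by
    have hw : N • P.cupCocycle f g = 0 := Subtype.ext (ContinuousMap.ext fun στ => hZ _)
    rw [hc, ← twoCocycleClassₗ_apply, ← map_nsmul, hw, map_zero]
  -- `2 • c = 0`
  have h2 : (2 : ℕ) • c = 0 := by
    rw [two_nsmul]
    nth_rw 1 [hcomm]
    rw [neg_add_cancel]
  obtain ⟨m, rfl⟩ := hN
  rw [add_smul, one_smul, mul_comm, mul_smul, h2, smul_zero, zero_add] at hNc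
  exact hNc

end Literature.NumberTheory.GaloisRepresentations.ContPairing

/-! ## §2 Howard: the transverse condition is isotropic under `∪_e` and under `∪_e ∘ transport` -/

namespace Literature.NumberTheory.GaloisCohomology.Howard2004

open Literature.NumberTheory.GaloisRepresentations
open Literature.NumberTheory.GaloisRepresentations.DiscreteGaloisModule

variable {K : Type} [Field K] [NumberField K] {M : Type} [AddCommGroup M] [TopologicalSpace M]
  [DiscreteTopology M] {R : Type} [CommRing R] [Module R M] [TopologicalSpace R] [DiscreteTopology R]
  {p : ℕ} [Fact p.Prime] [Algebra ℤ_[p] R] {cd : ConjugationDatum K} {ρ : DiscreteGaloisModule K M}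

namespace DualityDatum

/-- **`H¹_tr(K_v, T) ∪_e H¹_tr(K_v, Tw T) = 0`** at a finite place `v` of residue characteristic `ℓ` where `Γ_{K_v}` acts
trivially on `T` and on `Tw T`, `T` is `p`-primary, the values `R(1)` are killed by an odd `N`, and
`Γ_{K_v} = ⋃_j σ₀^j (Γ_{K_v} ∩ Γ_{K[ℓ]})` (the quotient is the cyclic group `Gal(K[ℓ]_v/K_v)` at an inert Kolyvagin prime).
[cite: Howard2004HeegnerKolyvagin, §1.3 H.4 (arXiv p. 7 L78–82) and Lemma 1.5.6–1.5.7 (p. 10 L86–88, L118–119: «isotropy of the … transverse submodules»)] [cite: NeukirchSchmidtWingberg2008, I §4 (1.4.4)] -/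
theorem localCup_eq_zero_of_mem_transverseCondition (D : DualityDatum p cd ρ R) (ℓ : ℕ)
    (jbar : AlgebraicClosure K →+* ℂ) (v : HeightOneSpectrum (𝓞 K))
    (htriv : ∀ (g : absoluteGaloisGroup (v.adicCompletion K)) (x : M), GaloisRep.toLocal v ρ g x = x)
    (htrivTw : ∀ (g : absoluteGaloisGroup (v.adicCompletion K)) (x : M), GaloisRep.toLocal v (cd.twist ρ) g x = x)
    (hp : ∀ x : M, ∃ n : ℕ, p ^ n • x = 0) {N : ℕ} (hN : Odd N) (hR : ∀ r : R, N • r = 0)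
    (σ₀ : absoluteGaloisGroup (v.adicCompletion K))
    (hcyc : ∀ σ, ∃ j : ℕ, (σ₀ ^ j)⁻¹ * σ ∈ localRingClassSubgroup ℓ jbar v)
    {x : galoisCohomology (ρ.toLocal (Sum.inr v)) 1} (hx : x ∈ transverseCondition p ρ ℓ jbar v)
    {y : galoisCohomology ((cd.twist ρ).toLocal (Sum.inr v)) 1} (hy : y ∈ transverseCondition p (cd.twist ρ) ℓ jbar v) :
    D.localCup (Sum.inr v) x y = 0 := by
  haveI : CompactSpace (absoluteGaloisGroup (Place.Completion (Sum.inr v : Place K))) :=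
    absoluteGaloisGroup_compactSpace _
  obtain ⟨f, rfl⟩ := oneCocycleClass_surjective _ x
  obtain ⟨g, rfl⟩ := oneCocycleClass_surjective _ y
  have hf := (oneCocycleClass_mem_transverseCondition_iff_forall_localRingClassSubgroup (p := p) ρ ℓ jbar v htriv hp
    f).1 hx
  have hg := (oneCocycleClass_mem_transverseCondition_iff_forall_localRingClassSubgroup (p := p) (cd.twist ρ) ℓ jbar v
    htrivTw hp g).1 hy
  change (D.ePairingLocal (Sum.inr v)).cupProduct (oneCocycleClass _ f) (oneCocycleClass _ g) = 0
  exact (D.ePairingLocal (Sum.inr v)).cupProduct_eq_zero_of_factor_cyclic (fun σ m => htriv σ m)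
    (fun σ m => htrivTw σ m) (localRingClassSubgroup ℓ jbar v) σ₀ hcyc f g hf hg hN (fun r => hR r)

end DualityDatum

namespace ConjugationDatum

/-- **The transport carries the transverse condition at `σ v` into the transverse condition of `Tw T` at `v`** when the
local transport `φ_v` maps `Γ_{K_v} ∩ Γ_{K[ℓ]}` into `Γ_{K_{σv}} ∩ Γ_{K[ℓ]}` (trivial local actions, `T` `p`-primary; on
cocycles: `h ↦ δ_v · c(φ_v h)` kills `Λ_v` when `c` kills `Λ_{σ v}`).
[cite: Howard2004HeegnerKolyvagin, §1.2–§1.3 (arXiv p. 6 L84–95, p. 7 L44–48)] -/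
theorem transportH1_mem_transverseCondition (cd : ConjugationDatum K) (ρ : DiscreteGaloisModule K M) (ℓ : ℕ)
    (jbar : AlgebraicClosure K →+* ℂ) (v : HeightOneSpectrum (𝓞 K))
    (htriv' : ∀ (g : absoluteGaloisGroup ((cd.σ • v).adicCompletion K)) (x : M), GaloisRep.toLocal (cd.σ • v) ρ g x = x)
    (htrivTw : ∀ (g : absoluteGaloisGroup (v.adicCompletion K)) (x : M), GaloisRep.toLocal v (cd.twist ρ) g x = x)
    (hp : ∀ x : M, ∃ n : ℕ, p ^ n • x = 0)
    (hφ : ∀ h ∈ localRingClassSubgroup ℓ jbar v, cd.φ v h ∈ localRingClassSubgroup ℓ jbar (cd.σ • v))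
    {y' : galoisCohomology (ρ.toLocal (Sum.inr (cd.σ • v))) 1} (hy' : y' ∈ transverseCondition p ρ ℓ jbar (cd.σ • v)) :
    cd.transportH1 ρ v y' ∈ transverseCondition p (cd.twist ρ) ℓ jbar v := by
  obtain ⟨c, rfl⟩ := oneCocycleClass_surjective _ y'
  have hc := (oneCocycleClass_mem_transverseCondition_iff_forall_localRingClassSubgroup (p := p) ρ ℓ jbar (cd.σ • v)
    htriv' hp c).1 hy'
  rw [transportH1_oneCocycleClass]
  refine (oneCocycleClass_mem_transverseCondition_iff_forall_localRingClassSubgroup (p := p) (cd.twist ρ) ℓ jbar v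
    htrivTw hp _).2 fun h hh => ?_
  rw [contOneCocycles.pullback_apply, transportHom_hom_apply, hc _ (hφ h hh), map_zero]

end ConjugationDatum

namespace DualityDatum

/-- **Isotropy of the transverse condition under Howard's induced local pairing** (`htr`; the isotropy half of H.4 for
`𝓕(n)` at a prime `λ ∣ n`): `x ∪_e transport_v(y') = 0` for `x ∈ H¹_tr(K_v, T)` and `y' ∈ H¹_tr(K_{σ v}, T)`, under the
hypotheses of `localCup_eq_zero_of_mem_transverseCondition` and `transportH1_mem_transverseCondition`.
[cite: Howard2004HeegnerKolyvagin, §1.3 H.4 (arXiv p. 7 L78–82) and Lemma 1.5.6–1.5.7 (p. 10 L86–88, L118–119)] [cite: NeukirchSchmidtWingberg2008, I §4 (1.4.4)] -/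
theorem localCup_transportH1_eq_zero_of_mem_transverseCondition (D : DualityDatum p cd ρ R) (ℓ : ℕ)
    (jbar : AlgebraicClosure K →+* ℂ) (v : HeightOneSpectrum (𝓞 K))
    (htriv : ∀ (g : absoluteGaloisGroup (v.adicCompletion K)) (x : M), GaloisRep.toLocal v ρ g x = x)
    (htriv' : ∀ (g : absoluteGaloisGroup ((cd.σ • v).adicCompletion K)) (x : M), GaloisRep.toLocal (cd.σ • v) ρ g x = x)
    (htrivTw : ∀ (g : absoluteGaloisGroup (v.adicCompletion K)) (x : M), GaloisRep.toLocal v (cd.twist ρ) g x = x)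
    (hp : ∀ x : M, ∃ n : ℕ, p ^ n • x = 0) {N : ℕ} (hN : Odd N) (hR : ∀ r : R, N • r = 0)
    (σ₀ : absoluteGaloisGroup (v.adicCompletion K))
    (hcyc : ∀ σ, ∃ j : ℕ, (σ₀ ^ j)⁻¹ * σ ∈ localRingClassSubgroup ℓ jbar v)
    (hφ : ∀ h ∈ localRingClassSubgroup ℓ jbar v, cd.φ v h ∈ localRingClassSubgroup ℓ jbar (cd.σ • v))
    {x : galoisCohomology (ρ.toLocal (Sum.inr v)) 1} (hx : x ∈ transverseCondition p ρ ℓ jbar v)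
    {y' : galoisCohomology (ρ.toLocal (Sum.inr (cd.σ • v))) 1} (hy' : y' ∈ transverseCondition p ρ ℓ jbar (cd.σ • v)) :
    D.localCup (Sum.inr v) x (cd.transportH1 ρ v y') = 0 :=
  D.localCup_eq_zero_of_mem_transverseCondition ℓ jbar v htriv htrivTw hp hN hR σ₀ hcyc hx
    (cd.transportH1_mem_transverseCondition ρ ℓ jbar v htriv' htrivTw hp hφ hy')

/-- The same in the shape of the hypothesis `hiso` of `RelaxedSelmerIsotropyProofs` / the «→» half of
`IsSelfOrthogonalAt` for a structure whose components at `v` and `σ v` are the transverse conditions: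
`∀ x ∈ 𝓣_v, ∀ y ∈ (𝓣_{σv}).map transport_v, x ∪_e y = 0`.
[cite: Howard2004HeegnerKolyvagin, §1.3 H.4 (arXiv p. 7 L78–82) and Def. 1.2.2] -/
theorem forall_localCup_eq_zero_of_transverse (D : DualityDatum p cd ρ R) (ℓ : ℕ)
    (jbar : AlgebraicClosure K →+* ℂ) (v : HeightOneSpectrum (𝓞 K)) (𝓣 : SelmerStructure ρ)
    (h𝓣v : 𝓣 (Sum.inr v) = transverseCondition p ρ ℓ jbar v)
    (h𝓣v' : 𝓣 (Sum.inr (cd.σ • v)) = transverseCondition p ρ ℓ jbar (cd.σ • v))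
    (htriv : ∀ (g : absoluteGaloisGroup (v.adicCompletion K)) (x : M), GaloisRep.toLocal v ρ g x = x)
    (htriv' : ∀ (g : absoluteGaloisGroup ((cd.σ • v).adicCompletion K)) (x : M), GaloisRep.toLocal (cd.σ • v) ρ g x = x)
    (htrivTw : ∀ (g : absoluteGaloisGroup (v.adicCompletion K)) (x : M), GaloisRep.toLocal v (cd.twist ρ) g x = x)
    (hp : ∀ x : M, ∃ n : ℕ, p ^ n • x = 0) {N : ℕ} (hN : Odd N) (hR : ∀ r : R, N • r = 0)
    (σ₀ : absoluteGaloisGroup (v.adicCompletion K))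
    (hcyc : ∀ σ, ∃ j : ℕ, (σ₀ ^ j)⁻¹ * σ ∈ localRingClassSubgroup ℓ jbar v)
    (hφ : ∀ h ∈ localRingClassSubgroup ℓ jbar v, cd.φ v h ∈ localRingClassSubgroup ℓ jbar (cd.σ • v)) :
    ∀ x ∈ 𝓣 (Sum.inr v), ∀ y ∈ (𝓣 (Sum.inr (cd.σ • v))).map (cd.transportH1 ρ v), D.localCup (Sum.inr v) x y = 0 := by
  rintro x hx y ⟨y', hy', rfl⟩
  rw [h𝓣v] at hx
  rw [h𝓣v'] at hy'
  exact D.localCup_transportH1_eq_zero_of_mem_transverseCondition ℓ jbar v htriv htriv' htrivTw hp hN hR σ₀ hcyc hφ hx hy'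

end DualityDatum

end Literature.NumberTheory.GaloisCohomology.Howard2004

end
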